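import Mathlib
import Summits.AtomisticToContinuum.Crystallization.Theses.IsometryAtoms
import Literature.Geometry.DiscreteGeometry.MultiregularPointSystems

/-!
# Line `Sketch` (inverse-stabiliser law ∘ coaxial collapse) — crux `IsometryAtoms.AtomicLawChargesCrystal`
# (stmt-AtomisticToContinuum-15778)

Route `route-AtomisticToContinuum-IsometryAtoms`, sub-problem `Crystallization`; lead prover's skeleton
(`Cruxes/AtomicLawChargesCrystal/Lines/Sketch.lean`, registered with `ledger skeleton check`).

The crux (FIXED — the route's decl, never restated): a probability law `P` on rooted configurations of `ℝ³`,
a.s. `δ`-hard-core, point-stationary (Mecke identity), a.s. relatively dense, with an atom modulo isometry at `Y`,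
charges every `(R, ε)`-window of ONE `Q : PeriodicConfiguration 3` (in fact `Q.points = Y`).

## The line

It composes the two crux ideas `inverse-stabiliser-law` (Palm half) and `coaxial-collapse` (geometric half):
compared with the registered lines `birth` / `so3_commutator`, the Palm half delivers the STRONGER output
"finitely many symmetry orbits" (detailed two-event Mecke balance `m(a)·n_ab(r) = m(b)·n_ba(r)` times the
inversion symmetry `n_ab·|Stab b| = n_ba·|Stab a|`, so `m(b)·|Stab b| = m(a)·|Stab a|` for every orbit `b`, and a
uniform stabiliser bound makes the orbit set finite), which makes the geometric half SOFT (cocompactness instead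
of cubic growth: no `O(r)` / `O(r²)` / `O(r³)` counts, no Voronoi cells, no named fact):

* `deloneOfRealisedClass` (PROVED here, = birth/so3 stub 1): a realised hard-core relatively dense copy makes `Y`
  a `Delone.DeloneSet`.
* S2 `stub_measurableSet_isometryClass` (VERBATIM birth/so3 stub 2): Giry measurability of a rooted isometry class.
* SB `stub_stabiliserBound`: (i) an affine isometry fixing pointwise the patch `D ∩ B̄(x, 20 R_c)` of a Delone set
  is the identity (the patch contains an affine frame); (ii) hence point stabilisers in `Sym(D)` are finite of
  uniformly bounded order (they act faithfully on a patch of uniformly bounded cardinality).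
* S3' `stub_finiteOrbitsOfChargedClass` (THE PALM LEVER, lead's stub): point-stationary `P`, a.s. rooted
  hard-core, charging the atom event of a Delone `D` (classes measurable, stabilisers uniformly bounded) ⇒
  `HasFinitelyManySymmetryOrbits D`.  Mecke with the two-event transport
  `g(μ,y) = 1_{C_a}(μ)·1_{C_b}(θ_y κμ)·1{‖y‖ ≤ r}` (`κ` the s-finite identity kernel on locally finite
  configurations, `Literature.Probability.Process.exists_isSFiniteKernel_apply_eq_self`).
* TK `stub_so3Toolkit`: five facts on linear isometries of `ℝ³` (accumulation in an infinite set of them; a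
  near-identity one fixes a unit vector; its fixed space is that line; two near-identity ones with a common fixed
  unit vector commute; `A - 1` is onto `u^⊥` for a near-identity `A ≠ 1` with axis `u`).
* G1a `stub_smallPartsCommute` (Bieberbach's lemma, conclusion VERBATIM so3's G1a; hypotheses: SB(i), TK):
  small linear parts of symmetries of a Delone set commute (commutator contraction + discreteness).
* FPG `stub_finitePointGroup` (coaxial collapse; hypotheses TK, G1a-conclusion): a Delone set with finitely many
  symmetry orbits has a finite point group `{g.linear : g ∈ Sym D}` (else small rotations accumulate, all about
  one axis `u` by G1a; translations lie on `ℝu`; the generator `g₀` commutes with all its conjugates, so its axis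
  line is `Sym(D)`-invariant — contradicting cocompactness).
* LFP `stub_periodicOfFinitePointGroup`: finitely many orbits + finite point group ⇒ the translation vectors form
  a full lattice `L` (cosets of `T` are finitely many, cocompactness forces `span T = ℝ³`, uniform discreteness
  gives `DiscreteTopology`) and `D = Q.points` for the `PeriodicConfiguration` with lattice `L` and motif
  `D ∩ (fundamental domain)`.

Composition (sorry-free, below): extraction of a realised copy (`Measure.exists_mem_of_measure_ne_zero_of_ae`) →
Delone → SB → S3' (with S2) → TK → G1a → FPG → LFP → windows (the atom event lies in every matching event).

Disproof / negatives honoured: `Negative.FalseWithoutRelDense` (relative density is consumed: Delone covering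
radius in SB's frame, cocompactness in FPG/LFP); `Negative.LatticeLaw.frame_inhabited` (`ℤ³`: one orbit,
`|Stab| = 48`, point group `O_h` finite, `T = ℤ³`) consistent with every stub.  No `Disproof.lean` published yet.
-/

noncomputable section

namespace Summit.AtomisticToContinuum.Crystallization.Cruxes.AtomicLawChargesCrystal.Sketch

open MeasureTheory Metric

/-- Euclidean `3`-space (notation only). -/
local notation "E3" => EuclideanSpace ℝ (Fin 3)

/-- The crux through its constant (definitional unfolding, for the reader). -/
theorem crux_iff :
    Summit.AtomisticToContinuum.Crystallization.Theses.IsometryAtoms.AtomicLawChargesCrystal ↔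
      (∀ δ : ℝ, 0 < δ → ∀ P : MeasureTheory.Measure (MeasureTheory.Measure (EuclideanSpace ℝ (Fin 3))), MeasureTheory.IsProbabilityMeasure P → (∀ᵐ μ ∂P, Literature.Probability.Process.IsRootedHardCore δ μ) → Literature.Probability.Process.IsPointStationaryLaw P → (∀ᵐ μ ∂P, ∃ R₀ : ℝ, ∀ z : EuclideanSpace ℝ (Fin 3), ∃ y : EuclideanSpace ℝ (Fin 3), μ {y} ≠ 0 ∧ dist z y ≤ R₀) → (∃ Y : Set (EuclideanSpace ℝ (Fin 3)), 0 < P {μ | ∃ A : EuclideanSpace ℝ (Fin 3) →ₗᵢ[ℝ] EuclideanSpace ℝ (Fin 3), ∃ q ∈ Y, μ = (MeasureTheory.Measure.count : MeasureTheory.Measure (EuclideanSpace ℝ (Fin 3))).restrict ((fun s => A (s - q)) '' Y)}) → ∃ Q : Literature.MathematicalPhysics.StatisticalMechanics.PeriodicConfiguration 3, ∀ R ε : ℝ, 0 < R → 0 < ε → 0 < P {μ | ∃ A : EuclideanSpace ℝ (Fin 3) →ₗᵢ[ℝ] EuclideanSpace ℝ (Fin 3), ∃ q ∈ Q.points, (∀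 s ∈ Q.points, dist s q ≤ R → ∃ y : EuclideanSpace ℝ (Fin 3), μ {y} ≠ 0 ∧ dist y (A (s - q)) ≤ ε) ∧ (∀ y : EuclideanSpace ℝ (Fin 3), μ {y} ≠ 0 → ‖y‖ ≤ R → ∃ s ∈ Q.points, dist y (A (s - q)) ≤ ε)}) :=
  Iff.rfl

/-! ## Step B, proved: a realised hard-core relatively dense copy makes `Y` Delone (= birth/so3 stub 1) -/

/-- **A realised hard-core, relatively dense copy makes `Y` Delone** (the statement of birth/so3 stub 1, proved):
if `count|((fun s => A (s - q)) '' Y)` is a rooted `δ`-hard-core configuration (`δ > 0`) and relatively dense,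
then `Y` carries a `Delone.DeloneSet` structure (packing radius `δ/2`, covering radius `max R₀ 1`): the carrier of
the counting measure is recovered by `count_restrict_singleton_ne_zero_iff`, and separation / covering pull back
along the isometry `s ↦ A (s - q)`. -/
theorem deloneOfRealisedClass : ∀ δ : ℝ, 0 < δ → ∀ (Y : Set (EuclideanSpace ℝ (Fin 3))) (A : EuclideanSpace ℝ (Fin 3) →ₗᵢ[ℝ] EuclideanSpace ℝ (Fin 3)) (q : EuclideanSpace ℝ (Fin 3)), Literature.Probability.Process.IsRootedHardCore δ ((MeasureTheory.Measure.count : MeasureTheory.Measure (EuclideanSpace ℝ (Fin 3))).restrict ((fun s => A (s - q)) '' Y)) → (∃ R₀ : ℝ, ∀ z : EuclideanSpace ℝ (Fin 3), ∃ y : EuclideanSpace ℝ (Fin 3), ((MeasureTheory.Measure.count : MeasureTheory.Measure (EuclideanSpace ℝ (Fin 3))).restrict ((fun s => A (s - q)) '' Y)) {y} ≠ 0 ∧ dist z y ≤ R₀) → ∃ D : Delone.DeloneSet (EuclideanSpace ℝ (Fin 3)), (D : Set (EuclideanSpace ℝ (Fin 3))) = Y := by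
  intro δ hδ Y A q hHC hRD
  obtain ⟨S, -, hsep, hS⟩ := hHC
  obtain ⟨R₀, hR₀⟩ := hRD
  -- the carrier of the counting measure is the image set
  have himg : ∀ y, y ∈ (fun s => A (s - q)) '' Y ↔ y ∈ S := fun y => by
    rw [← Literature.Probability.Process.count_restrict_singleton_ne_zero_iff ((fun s => A (s - q)) '' Y) y,
      hS, Literature.Probability.Process.count_restrict_singleton_ne_zero_iff]
  -- separation pulls back
  have hsepY : ∀ x ∈ Y, ∀ y ∈ Y, x ≠ y → δ ≤ dist x y := by
    intro x hx y hy hxy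
    have hx' : A (x - q) ∈ S := (himg _).1 ⟨x, hx, rfl⟩
    have hy' : A (y - q) ∈ S := (himg _).1 ⟨y, hy, rfl⟩
    have hne : A (x - q) ≠ A (y - q) := fun h => hxy (by simpa using A.injective h)
    have := hsep _ hx' _ hy' hne
    rwa [A.dist_map, dist_sub_right] at this
  -- covering pulls back
  have hcovY : ∀ z : E3, ∃ y ∈ Y, dist z y ≤ max R₀ 1 := by
    intro z
    obtain ⟨y, hy, hzy⟩ := hR₀ (A (z - q))
    rw [Literature.Probability.Process.count_restrict_singleton_ne_zero_iff] at hy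
    obtain ⟨s, hs, rfl⟩ := hy
    refine ⟨s, hs, ?_⟩
    rw [A.dist_map, dist_sub_right] at hzy
    exact hzy.trans (le_max_left _ _)
  refine ⟨{ carrier := Y, packingRadius := (δ / 2).toNNReal, packingRadius_pos := Real.toNNReal_pos.mpr (by positivity), isSeparated_packingRadius := ?_, coveringRadius := (max R₀ 1).toNNReal, coveringRadius_pos := Real.toNNReal_pos.mpr (by positivity), isCover_coveringRadius := ?_ }, rfl⟩
  · intro x hx y hy hxy
    have h := hsepY x hx y hy hxy
    show ENNReal.ofReal (δ / 2) < edist x y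
    rw [edist_dist]
    exact (ENNReal.ofReal_lt_ofReal_iff (dist_pos.2 hxy)).2 (by linarith)
  · rw [Metric.isCover_iff_subset_iUnion_closedBall]
    intro z _
    obtain ⟨y, hy, hzy⟩ := hcovY z
    refine Set.mem_iUnion₂.2 ⟨y, hy, Metric.mem_closedBall.2 ?_⟩
    rw [Real.coe_toNNReal _ (by positivity)]
    exact hzy

/-! ## The stubs (registered obligations; signatures over Mathlib / Literature / route declarations only) -/

/-- **S2 — GIRY MEASURABILITY OF A ROOTED ISOMETRY CLASS** (= birth/so3 stub 2, verbatim; size L).  For a Delone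
`D ⊆ ℝ³` and any `q`, `{count|A(D − q) : A a linear isometry}` is measurable in `Measure.instMeasurableSpace`.
Route: `μ` is in the class iff (a) `μ (closedBall 0 n) = #(D ∩ closedBall q n)` for every `n : ℕ` and (b) for every
`k : ℕ` some `A` in a COUNTABLE DENSE set of linear isometries has `1 ≤ μ (ball (A (s - q)) (1/(k+1)))` for all
`s ∈ D ∩ closedBall q k` — (a), (b) are countably many evaluation conditions; the converse direction extracts a
convergent subsequence of the `A_k` in the compact isometry group and identifies `μ` with `count|A*(D − q)` ball by
ball (continuity from above on finite `μ|closedBall 0 (n+1)`).  Leans on: `Measure.measurable_coe`,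
`TopologicalSpace.exists_countable_dense` on the (compact, second-countable) isometries inside `E3 →L[ℝ] E3`,
`IsCompact.tendsto_subseq`, `Literature.Probability.Process.count_restrict_singleton_ne_zero_iff`;
LastPenrose2017 Ch. 2. -/
theorem stub_measurableSet_isometryClass : ∀ (D : Delone.DeloneSet (EuclideanSpace ℝ (Fin 3))) (q : EuclideanSpace ℝ (Fin 3)), MeasurableSet {μ : MeasureTheory.Measure (EuclideanSpace ℝ (Fin 3)) | ∃ A : EuclideanSpace ℝ (Fin 3) →ₗᵢ[ℝ] EuclideanSpace ℝ (Fin 3), μ = (MeasureTheory.Measure.count : MeasureTheory.Measure (EuclideanSpace ℝ (Fin 3))).restrict ((fun s => A (s - q)) '' (D : Set (EuclideanSpace ℝ (Fin 3))))} := by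
  sorry

/-- **SB — AFFINE FRAMES IN PATCHES; STABILISERS ARE UNIFORMLY FINITE** (size M; metric geometry).
(i) If an affine isometry `g` of `ℝ³` fixes every point of the patch `D ∩ B̄(x, 20·R_c)` of a Delone set `D`
(`R_c` its covering radius, `x ∈ D`), then `g = 1`: the patch contains `x` and points `pᵢ` within `R_c` of
`x + 10 R_c eᵢ`, and `pᵢ - x = 10 R_c eᵢ + εᵢ` (`‖εᵢ‖ ≤ R_c`) are linearly independent, so `g.linear = 1` and `g`
fixes `x`.  (ii) Hence for every Delone `D` there is `N` with `|Stab_{Sym D}(x)| ≤ N` for all `x ∈ D`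
(`encard ≤ N`, so in particular finite): a stabiliser element is determined by its action on the patch, which it
permutes, and patches have uniformly bounded cardinality (packing).  Why it might fail: only through constants
(any radius `≥ 12 R_c` works).  Leans on: `Delone.DeloneSet.exists_dist_le_coveringRadius`,
`packingRadius_lt_dist_of_mem_ne`, `AffineIsometryEquiv` (`.linear`, `map_vsub`), `EuclideanSpace.single`,
`Literature.Probability.Process.finite_inter_of_separated` / packing counts, `Set.encard`. -/
theorem stub_stabiliserBound :
    (∀ (D : Delone.DeloneSet (EuclideanSpace ℝ (Fin 3))) (g : EuclideanSpace ℝ (Fin 3) ≃ᵃⁱ[ℝ] EuclideanSpace ℝ (Fin 3)), ∀ x ∈ (D : Set (EuclideanSpace ℝ (Fin 3))), (∀ p ∈ (D : Set (EuclideanSpace ℝ (Fin 3))), dist p x ≤ 20 * (D.coveringRadius : ℝ) → g p = p) → ∀ y : EuclideanSpace ℝ (Fin 3), g y = y) ∧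
    (∀ D : Delone.DeloneSet (EuclideanSpace ℝ (Fin 3)), ∃ N : ℕ, ∀ x ∈ (D : Set (EuclideanSpace ℝ (Fin 3))), {g : EuclideanSpace ℝ (Fin 3) ≃ᵃⁱ[ℝ] EuclideanSpace ℝ (Fin 3) | g '' (D : Set (EuclideanSpace ℝ (Fin 3))) = (D : Set (EuclideanSpace ℝ (Fin 3))) ∧ g x = x}.encard ≤ N) := by
  sorry

/-- **S3' — DETAILED MASS TRANSPORT: A CHARGED ISOMETRY CLASS HAS FINITELY MANY SYMMETRY ORBITS** (size L; the
route's NEW Palm lever, idea `inverse-stabiliser-law`; lead's stub).  For `δ > 0`, a point-stationary probability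
law `P`, a.s. rooted `δ`-hard-core, and a Delone `D` whose rooted isometry classes `C_q` are measurable, whose atom
event `⋃_{q ∈ D} C_q` has positive mass and whose stabilisers are uniformly bounded (`|Stab x| ≤ N`):
`HasFinitelyManySymmetryOrbits D`.  Proof: some `C_a` is charged (`m(a) > 0`, σ-subadditivity over the countable
`D`); Mecke with `g(μ,y) = 1_{C_a}(μ)·1_{C_b}(θ_y κμ)·1{‖y‖ ≤ r}` (κ the s-finite identity kernel on locally finite
configurations) gives `m(a)·n(b;a,r) = m(b)·n(a;b,r)` with `n(b;a,r) = #(Sym(D)b ∩ B̄(a,r))`; the bijection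
`γ ↦ γ⁻¹` of `Sym D` gives `n(b;a,r)·|Stab b| = n(a;b,r)·|Stab a|`; at `r = dist a b` (`n(b;a,r) ≥ 1`) this yields
`m(b) = m(a)|Stab a|/|Stab b| ≥ m(a)/N`; class events of inequivalent roots are disjoint, so at most `N/m(a)`
orbits.  Why it might fail: measurability bookkeeping of the two-event transport (handled by
`measurable_map_sub_kernel`); the graph analogue fails only through UNBOUNDED stabilisers (canopy tree), excluded by
hypothesis.  Leans on: `IsPointStationaryLaw`, `exists_isSFiniteKernel_apply_eq_self`, `measurable_map_sub_kernel`,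
`map_sub_count_restrict`, `IsRootedHardCore.map_sub`, `count_restrict_singleton_ne_zero_iff`,
`finite_inter_of_separated`, `lintegral_countable`; AldousLyons2007 Thm 3.1, LyonsPeres2016 §8.2,
HevelingLast2005, LastPenrose2017 §9.3. -/
theorem stub_finiteOrbitsOfChargedClass : ∀ δ : ℝ, 0 < δ → ∀ P : MeasureTheory.Measure (MeasureTheory.Measure (EuclideanSpace ℝ (Fin 3))), MeasureTheory.IsProbabilityMeasure P → (∀ᵐ μ ∂P, Literature.Probability.Process.IsRootedHardCore δ μ) → Literature.Probability.Process.IsPointStationaryLaw P → ∀ D : Delone.DeloneSet (EuclideanSpace ℝ (Fin 3)), (∀ q : EuclideanSpace ℝ (Fin 3), MeasurableSet {μ : MeasureTheory.Measure (EuclideanSpace ℝ (Fin 3)) | ∃ A : EuclideanSpace ℝ (Fin 3) →ₗᵢ[ℝ] EuclideanSpace ℝ (Fin 3), μ = (MeasureTheory.Measure.count : MeasureTheory.Measure (EuclideanSpace ℝ (Fin 3))).restrict ((fun s => A (s - q)) '' (D : Set (EuclideanSpace ℝ (Fin 3))))}) → 0 < P {μ | ∃ A : EuclideanSpace ℝ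 (Fin 3) →ₗᵢ[ℝ] EuclideanSpace ℝ (Fin 3), ∃ q ∈ (D : Set (EuclideanSpace ℝ (Fin 3))), μ = (MeasureTheory.Measure.count : MeasureTheory.Measure (EuclideanSpace ℝ (Fin 3))).restrict ((fun s => A (s - q)) '' (D : Set (EuclideanSpace ℝ (Fin 3))))} → (∃ N : ℕ, ∀ x ∈ (D : Set (EuclideanSpace ℝ (Fin 3))), {g : EuclideanSpace ℝ (Fin 3) ≃ᵃⁱ[ℝ] EuclideanSpace ℝ (Fin 3) | g '' (D : Set (EuclideanSpace ℝ (Fin 3))) = (D : Set (EuclideanSpace ℝ (Fin 3))) ∧ g x = x}.encard ≤ N) → Literature.Geometry.DiscreteGeometry.HasFinitelyManySymmetryOrbits (D : Set (EuclideanSpace ℝ (Fin 3))) := by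
  sorry

/-- **TK — SO(3) TOOLKIT: FIVE FACTS ON LINEAR ISOMETRIES OF `ℝ³`** (size L; pure linear algebra).
(T0) an infinite set of linear isometries of `ℝ³` contains two distinct elements `A ≠ B` with
`‖A x - B x‖ ≤ ε‖x‖` (compactness / total boundedness of `O(3)` inside the proper space `E3 →L[ℝ] E3`);
(T1) a linear isometry `A` with `‖A x - x‖ ≤ ‖x‖/2` fixes a unit vector (`det (A - 1) = 0` by the transpose
trick, `-1` is not an eigenvalue); (T2) if moreover `A ≠ 1` fixes the unit vector `u`, its fixed vectors are the
multiples of `u` (a second fixed direction would force `A = 1` or an eigenvalue `-1` on the orthogonal line);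
(T5) two such near-identity isometries fixing the same unit vector commute (on `u^⊥`, a `2`-plane, both are
rotations `Orientation.rotation θ`, `det = -1` being excluded by smallness, and rotations commute);
(T7) for such `A ≠ 1` with axis `u`, `A - 1` maps `u^⊥` ONTO `u^⊥` (injective on the finite-dimensional `u^⊥`).
Why it might fail: only through constants (`1/2 < 2` excludes the eigenvalue `-1`; fine).  Leans on:
`LinearMap.det`, `LinearMap.bot_lt_ker_of_det_eq_zero`, `LinearMap.toMatrix_adjoint`/`Matrix.det_transpose`,
`LinearIsometryEquiv.adjoint_eq_symm`, `finrank_orthogonal_span_singleton`,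
`Orientation.exists_linearIsometryEquiv_eq_of_det_pos`, `Orientation.rotation_rotation`,
`ProperSpace (E3 →L[ℝ] E3)`, `TotallyBounded`, `Set.Infinite.exists_ne_map_eq_of_mapsTo`. -/
theorem stub_so3Toolkit :
    (∀ S : Set (EuclideanSpace ℝ (Fin 3) ≃ₗᵢ[ℝ] EuclideanSpace ℝ (Fin 3)), S.Infinite → ∀ ε : ℝ, 0 < ε → ∃ A ∈ S, ∃ B ∈ S, A ≠ B ∧ ∀ x : EuclideanSpace ℝ (Fin 3), ‖A x - B x‖ ≤ ε * ‖x‖) ∧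
    (∀ A : EuclideanSpace ℝ (Fin 3) ≃ₗᵢ[ℝ] EuclideanSpace ℝ (Fin 3), (∀ x : EuclideanSpace ℝ (Fin 3), ‖A x - x‖ ≤ ‖x‖ / 2) → ∃ u : EuclideanSpace ℝ (Fin 3), ‖u‖ = 1 ∧ A u = u) ∧
    (∀ A : EuclideanSpace ℝ (Fin 3) ≃ₗᵢ[ℝ] EuclideanSpace ℝ (Fin 3), (∀ x : EuclideanSpace ℝ (Fin 3), ‖A x - x‖ ≤ ‖x‖ / 2) → ∀ u : EuclideanSpace ℝ (Fin 3), ‖u‖ = 1 → A u = u → (∃ x : EuclideanSpace ℝ (Fin 3), A x ≠ x) → ∀ v : EuclideanSpace ℝ (Fin 3), A v = v → ∃ c : ℝ, v = c • u) ∧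
    (∀ A B : EuclideanSpace ℝ (Fin 3) ≃ₗᵢ[ℝ] EuclideanSpace ℝ (Fin 3), (∀ x : EuclideanSpace ℝ (Fin 3), ‖A x - x‖ ≤ ‖x‖ / 2) → (∀ x : EuclideanSpace ℝ (Fin 3), ‖B x - x‖ ≤ ‖x‖ / 2) → ∀ u : EuclideanSpace ℝ (Fin 3), ‖u‖ = 1 → A u = u → B u = u → ∀ x : EuclideanSpace ℝ (Fin 3), A (B x) = B (A x)) ∧
    (∀ A : EuclideanSpace ℝ (Fin 3) ≃ₗᵢ[ℝ] EuclideanSpace ℝ (Fin 3), (∀ x : EuclideanSpace ℝ (Fin 3), ‖A x - x‖ ≤ ‖x‖ / 2) → ∀ u : EuclideanSpace ℝ (Fin 3), ‖u‖ = 1 → A u = u → (∃ x : EuclideanSpace ℝ (Fin 3), A x ≠ x) → ∀ w : EuclideanSpace ℝ (Fin 3), inner ℝ w u = 0 → ∃ c : EuclideanSpace ℝ (Fin 3), inner ℝ c u = 0 ∧ A c - c = w) := by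
  sorry

/-- **G1a — SMALL LINEAR PARTS OF SYMMETRIES OF A DELONE SET COMMUTE** (Bieberbach's lemma; size L; conclusion
VERBATIM `so3_commutator.stub_smallPartsCommute`, with SB(i) and TK (T1, T2, T5) as explicit hypotheses).
Proof (commutator contraction): with `κ₀ = g₂`, `κ_{j+1} = [g₁, κ_j] ∈ Sym D`, linear parts
`C_{j+1} = A₁C_jA₁⁻¹C_j⁻¹` satisfy `‖C_{j+1} - 1‖ ≤ 2‖A₁ - 1‖‖C_j - 1‖ ≤ (1/5)ʲ⁺¹/10`, translation parts (origin
at `x ∈ D`) `t_{[g,h]} = (1 - ABA⁻¹)a + (A - C)b`, so `‖t_{j+1}‖ ≤ ‖C_j - 1‖‖t₁‖ + (1/10 + ‖C_{j+1} - 1‖)‖t_j‖ → 0`;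
a symmetry moving every point of `D ∩ B̄(x, 20R_c)` by less than the packing radius fixes the patch, hence is `1`
(SB(i)); so `κ_J = 1` for some `J`, i.e. `C_J = 1`; downward, `C_{j+1} u₁ = u₁ ⇒ C_j⁻¹u₁ ∈ Fix(A₁) = ℝu₁ ⇒
C_j u₁ = u₁` (T2, smallness), whence `A₂ u₁ = u₁` for the axis `u₁` of `A₁` (T1), and T5 gives `A₁A₂ = A₂A₁`.
Why it might fail: constants (`2/10 + … < 1`: fine).  Leans on: `AffineIsometryEquiv` (group, `.linear`,
`coe_mul`, `coe_inv`, `map_vsub`), `Delone.DeloneSet.packingRadius_lt_dist_of_mem_ne`; Buser 1985, Thurston 1997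
§4.1, Wolf 2011 §3.2. -/
theorem stub_smallPartsCommute :
    (∀ (D : Delone.DeloneSet (EuclideanSpace ℝ (Fin 3))) (g : EuclideanSpace ℝ (Fin 3) ≃ᵃⁱ[ℝ] EuclideanSpace ℝ (Fin 3)), ∀ x ∈ (D : Set (EuclideanSpace ℝ (Fin 3))), (∀ p ∈ (D : Set (EuclideanSpace ℝ (Fin 3))), dist p x ≤ 20 * (D.coveringRadius : ℝ) → g p = p) → ∀ y : EuclideanSpace ℝ (Fin 3), g y = y) →
    (∀ A : EuclideanSpace ℝ (Fin 3) ≃ₗᵢ[ℝ] EuclideanSpace ℝ (Fin 3), (∀ x : EuclideanSpace ℝ (Fin 3), ‖A x - x‖ ≤ ‖x‖ / 2) → ∃ u : EuclideanSpace ℝ (Fin 3), ‖u‖ = 1 ∧ A u = u) →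
    (∀ A : EuclideanSpace ℝ (Fin 3) ≃ₗᵢ[ℝ] EuclideanSpace ℝ (Fin 3), (∀ x : EuclideanSpace ℝ (Fin 3), ‖A x - x‖ ≤ ‖x‖ / 2) → ∀ u : EuclideanSpace ℝ (Fin 3), ‖u‖ = 1 → A u = u → (∃ x : EuclideanSpace ℝ (Fin 3), A x ≠ x) → ∀ v : EuclideanSpace ℝ (Fin 3), A v = v → ∃ c : ℝ, v = c • u) →
    (∀ A B : EuclideanSpace ℝ (Fin 3) ≃ₗᵢ[ℝ] EuclideanSpace ℝ (Fin 3), (∀ x : EuclideanSpace ℝ (Fin 3), ‖A x - x‖ ≤ ‖x‖ / 2) → (∀ x : EuclideanSpace ℝ (Fin 3), ‖B x - x‖ ≤ ‖x‖ / 2) → ∀ u : EuclideanSpace ℝ (Fin 3), ‖u‖ = 1 → A u = u → B u = u → ∀ x : EuclideanSpace ℝ (Fin 3), A (B x) = B (A x)) →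
    ∀ D : Delone.DeloneSet (EuclideanSpace ℝ (Fin 3)), ∀ g₁ g₂ : EuclideanSpace ℝ (Fin 3) ≃ᵃⁱ[ℝ] EuclideanSpace ℝ (Fin 3), g₁ '' (D : Set (EuclideanSpace ℝ (Fin 3))) = (D : Set (EuclideanSpace ℝ (Fin 3))) → g₂ '' (D : Set (EuclideanSpace ℝ (Fin 3))) = (D : Set (EuclideanSpace ℝ (Fin 3))) → (∀ x : EuclideanSpace ℝ (Fin 3), ‖g₁.linear x - x‖ ≤ ‖x‖ / 10) → (∀ x : EuclideanSpace ℝ (Fin 3), ‖g₂.linear x - x‖ ≤ ‖x‖ / 10) → ∀ x : EuclideanSpace ℝ (Fin 3), g₁.linear (g₂.linear x) = g₂.linear (g₁.linear x) := by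
  sorry

/-- **FPG — COAXIAL COLLAPSE: FINITELY MANY ORBITS ⇒ FINITE POINT GROUP** (Bieberbach I for the case at hand;
size L; hypotheses TK (T0, T1, T2, T7) and the conclusion of G1a).  For a Delone `D ⊆ ℝ³` with finitely many
`Sym(D)`-orbits, the point group `{g.linear : g ∈ Sym D}` is finite.  Proof: (A) cocompactness — with orbit
representatives `S`, every `z` is within `R_c + max_{s ∈ S} dist(s, q₀)` of `Sym(D)·q₀` (`z` is `R_c`-close to
`x = g⁻¹ s ∈ D`, and `dist(g⁻¹q₀, x) = dist(q₀, s)`).  (B) if the point group `Π` is infinite: (T0) gives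
`g_ε ∈ Sym D` with `lin g_ε ≠ 1` arbitrarily close to `1`; fix `g₀`, `B₀ = lin g₀ ≠ 1` `ε₀`-small with axis `u`
(T1, T2); every `P ∈ Π` has `Pu = ±u` (`PB₀P⁻¹` is small, commutes with `B₀` by G1a, its fixed line is `P(ℝu)`);
the translation vectors `T = {v | D + v = D}` lie in `ℝu` (`B_ε v - v ∈ T` is shorter than the packing radius,
`Fix B_ε = ℝu`); `g₀` commutes with each conjugate `h = g g₀ g⁻¹` (`[g₀, h]` is a translation in `T ∩ u^⊥ = 0`:
linear parts commute by G1a, and `(1 - Q)t ⊥ u`); hence `h` preserves `ℓ₀ = {x | g₀x - x ∈ ℝu}`, which is the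
line `c₀ + ℝu` (T7, T2), and `g₀` preserves `g⁻¹ℓ₀ = g⁻¹c₀ + ℝu`, forcing `g⁻¹c₀ ∈ ℓ₀`, i.e. `ℓ₀` is
`Sym(D)`-invariant; then `Sym(D)·q₀` stays at distance `dist(q₀, ℓ₀)` from `ℓ₀`, contradicting (A) at a point
far from `ℓ₀`.  Why it might fail: the case analysis is closed (no orientation cases: only conjugates of `g₀` and
G1a are used); constants (`ε₀ ≤ 1/20` so that conjugates and `B_ε` stay `1/10`-small).  Leans on:
`AffineIsometryEquiv` (group, `.linear`, `constVAdd`), `Delone.DeloneSet`, `HasFinitelyManySymmetryOrbits`,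
`Metric.infDist`, `Submodule.mem_span_singleton`; Buser 1985, Thurston 1997 §4.2, Ratcliffe §7.5. -/
theorem stub_finitePointGroup :
    (∀ S : Set (EuclideanSpace ℝ (Fin 3) ≃ₗᵢ[ℝ] EuclideanSpace ℝ (Fin 3)), S.Infinite → ∀ ε : ℝ, 0 < ε → ∃ A ∈ S, ∃ B ∈ S, A ≠ B ∧ ∀ x : EuclideanSpace ℝ (Fin 3), ‖A x - B x‖ ≤ ε * ‖x‖) →
    (∀ A : EuclideanSpace ℝ (Fin 3) ≃ₗᵢ[ℝ] EuclideanSpace ℝ (Fin 3), (∀ x : EuclideanSpace ℝ (Fin 3), ‖A x - x‖ ≤ ‖x‖ / 2) → ∃ u : EuclideanSpace ℝ (Fin 3), ‖u‖ = 1 ∧ A u = u) →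
    (∀ A : EuclideanSpace ℝ (Fin 3) ≃ₗᵢ[ℝ] EuclideanSpace ℝ (Fin 3), (∀ x : EuclideanSpace ℝ (Fin 3), ‖A x - x‖ ≤ ‖x‖ / 2) → ∀ u : EuclideanSpace ℝ (Fin 3), ‖u‖ = 1 → A u = u → (∃ x : EuclideanSpace ℝ (Fin 3), A x ≠ x) → ∀ v : EuclideanSpace ℝ (Fin 3), A v = v → ∃ c : ℝ, v = c • u) →
    (∀ A : EuclideanSpace ℝ (Fin 3) ≃ₗᵢ[ℝ] EuclideanSpace ℝ (Fin 3), (∀ x : EuclideanSpace ℝ (Fin 3), ‖A x - x‖ ≤ ‖x‖ / 2) → ∀ u : EuclideanSpace ℝ (Fin 3), ‖u‖ = 1 → A u = u → (∃ x : EuclideanSpace ℝ (Fin 3), A x ≠ x) → ∀ w : EuclideanSpace ℝ (Fin 3), inner ℝ w u = 0 → ∃ c : EuclideanSpace ℝ (Fin 3), inner ℝ c u = 0 ∧ A c - c = w) →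
    (∀ D : Delone.DeloneSet (EuclideanSpace ℝ (Fin 3)), ∀ g₁ g₂ : EuclideanSpace ℝ (Fin 3) ≃ᵃⁱ[ℝ] EuclideanSpace ℝ (Fin 3), g₁ '' (D : Set (EuclideanSpace ℝ (Fin 3))) = (D : Set (EuclideanSpace ℝ (Fin 3))) → g₂ '' (D : Set (EuclideanSpace ℝ (Fin 3))) = (D : Set (EuclideanSpace ℝ (Fin 3))) → (∀ x : EuclideanSpace ℝ (Fin 3), ‖g₁.linear x - x‖ ≤ ‖x‖ / 10) → (∀ x : EuclideanSpace ℝ (Fin 3), ‖g₂.linear x - x‖ ≤ ‖x‖ / 10) → ∀ x : EuclideanSpace ℝ (Fin 3), g₁.linear (g₂.linear x) = g₂.linear (g₁.linear x)) →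
    ∀ D : Delone.DeloneSet (EuclideanSpace ℝ (Fin 3)), Literature.Geometry.DiscreteGeometry.HasFinitelyManySymmetryOrbits (D : Set (EuclideanSpace ℝ (Fin 3))) → {A : EuclideanSpace ℝ (Fin 3) ≃ₗᵢ[ℝ] EuclideanSpace ℝ (Fin 3) | ∃ g : EuclideanSpace ℝ (Fin 3) ≃ᵃⁱ[ℝ] EuclideanSpace ℝ (Fin 3), g '' (D : Set (EuclideanSpace ℝ (Fin 3))) = (D : Set (EuclideanSpace ℝ (Fin 3))) ∧ g.linearIsometryEquiv = A}.Finite := by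
  sorry

/-- **LFP — FINITELY MANY ORBITS + FINITE POINT GROUP ⇒ `D` IS THE POINT SET OF A `PeriodicConfiguration 3`**
(size L; soft).  Proof: the translation vectors `T = {v | ∀ x, x ∈ D ↔ x + v ∈ D}` form an additive subgroup,
uniformly discrete (`‖v‖ ≤ packing radius ⇒ v = 0`); with representatives `g_A ∈ Sym D` of the finitely many
linear parts, `g·g_{lin g}⁻¹` is a translation, so `Sym(D)·q₀ ⊆ T + {g_A q₀}`; cocompactness (finitely many orbits,
as in FPG (A)) then forbids `span_ℝ T ≠ ⊤` (a unit normal `n` of `span T` gives a point `(M + R₁ + 1)·n` far from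
the orbit), so `T` is a full-rank discrete `ℤ`-submodule (`IsZLattice`); finally `D`, non-empty, uniformly
discrete and `T`-invariant, is `Q.points` for `Q.lattice = T`, motif `D ∩ fundamentalDomain` of a `ℤ`-basis of
`T` (finite: bounded ∩ uniformly discrete; non-empty and exhausting via `ZSpan.fract`; pairwise inequivalent by
`ZSpan.exist_unique_vadd_mem_fundamentalDomain`).  Why it might fail: only side conditions of the structure
(covered).  Leans on: `AddSubgroup.toIntSubmodule`, `IsZLattice`, `discreteTopology` of a separated subgroup,
`Submodule.orthogonal_eq_bot_iff` / `Submodule.exists_mem_orthogonal`-type facts, `ZLattice.module_free`,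
`Module.Free.chooseBasis`, `Basis.ofZLatticeBasis(_span)`, `ZSpan.fundamentalDomain`,
`ZSpan.fract_mem_fundamentalDomain`, `ZSpan.fundamentalDomain_isBounded`, `Metric.finite_isBounded_inter_isClosed`,
`Literature.MathematicalPhysics.StatisticalMechanics.PeriodicConfiguration`; GrahamGrotschelLovasz1996 ch. 19
Thm 5.2, DolbilinLagariasSenechal1998 Thm 1.1. -/
theorem stub_periodicOfFinitePointGroup : ∀ D : Delone.DeloneSet (EuclideanSpace ℝ (Fin 3)), Literature.Geometry.DiscreteGeometry.HasFinitelyManySymmetryOrbits (D : Set (EuclideanSpace ℝ (Fin 3))) → {A : EuclideanSpace ℝ (Fin 3) ≃ₗᵢ[ℝ] EuclideanSpace ℝ (Fin 3) | ∃ g : EuclideanSpace ℝ (Fin 3) ≃ᵃⁱ[ℝ] EuclideanSpace ℝ (Fin 3), g '' (D : Set (EuclideanSpace ℝ (Fin 3))) = (D : Set (EuclideanSpace ℝ (Fin 3))) ∧ g.linearIsometryEquiv = A}.Finite → ∃ Q : Literature.MathematicalPhysics.StatisticalMechanics.PeriodicConfiguration 3, Q.points = (D : Set (EuclideanSpace ℝ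 (Fin 3))) := by
  sorry


/-! ## Composition (sorry-free) -/

/-- **Composition with explicit hypotheses** (sorry-free): the seven stubs' STATEMENTS, verbatim, imply the BODY
of the crux (`AtomicLawChargesCrystal` unfolded — see `crux_iff`).  Steps proved here: (A) extraction of one
realised hard-core, relatively dense copy of `Y` from the positive-measure atom event and the two a.s. clauses;
(B) `deloneOfRealisedClass`; (C) SB + S2 + S3' ⇒ finitely many orbits; (D) TK + G1a + FPG ⇒ finite point group,
LFP ⇒ `Q.points = Y`; (E) the atom event is contained in every `(R, ε)`-matching event of `Q`. -/
theorem AtomicLawChargesCrystal_of_stubs :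
    (∀ (D : Delone.DeloneSet (EuclideanSpace ℝ (Fin 3))) (q : EuclideanSpace ℝ (Fin 3)), MeasurableSet {μ : MeasureTheory.Measure (EuclideanSpace ℝ (Fin 3)) | ∃ A : EuclideanSpace ℝ (Fin 3) →ₗᵢ[ℝ] EuclideanSpace ℝ (Fin 3), μ = (MeasureTheory.Measure.count : MeasureTheory.Measure (EuclideanSpace ℝ (Fin 3))).restrict ((fun s => A (s - q)) '' (D : Set (EuclideanSpace ℝ (Fin 3))))}) →
    ((∀ (D : Delone.DeloneSet (EuclideanSpace ℝ (Fin 3))) (g : EuclideanSpace ℝ (Fin 3) ≃ᵃⁱ[ℝ] EuclideanSpace ℝ (Fin 3)), ∀ x ∈ (D : Set (EuclideanSpace ℝ (Fin 3))), (∀ p ∈ (D : Set (EuclideanSpace ℝ (Fin 3))), dist p x ≤ 20 * (D.coveringRadius : ℝ) → g p = p) → ∀ y : EuclideanSpace ℝ (Fin 3), g y = y) ∧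
      (∀ D : Delone.DeloneSet (EuclideanSpace ℝ (Fin 3)), ∃ N : ℕ, ∀ x ∈ (D : Set (EuclideanSpace ℝ (Fin 3))), {g : EuclideanSpace ℝ (Fin 3) ≃ᵃⁱ[ℝ] EuclideanSpace ℝ (Fin 3) | g '' (D : Set (EuclideanSpace ℝ (Fin 3))) = (D : Set (EuclideanSpace ℝ (Fin 3))) ∧ g x = x}.encard ≤ N)) →
    (∀ δ : ℝ, 0 < δ → ∀ P : MeasureTheory.Measure (MeasureTheory.Measure (EuclideanSpace ℝ (Fin 3))), MeasureTheory.IsProbabilityMeasure P → (∀ᵐ μ ∂P, Literature.Probability.Process.IsRootedHardCore δ μ) → Literature.Probability.Process.IsPointStationaryLaw P → ∀ D : Delone.DeloneSet (EuclideanSpace ℝ (Fin 3)), (∀ q : EuclideanSpace ℝ (Fin 3), MeasurableSet {μ : MeasureTheory.Measure (EuclideanSpace ℝ (Fin 3)) | ∃ A : EuclideanSpace ℝ (Fin 3) →ₗᵢ[ℝ] EuclideanSpace ℝ (Fin 3), μ = (MeasureTheory.Measure.count : MeasureTheory.Measure (EuclideanSpace ℝ (Fin 3))).restrict ((fun s =>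 A (s - q)) '' (D : Set (EuclideanSpace ℝ (Fin 3))))}) → 0 < P {μ | ∃ A : EuclideanSpace ℝ (Fin 3) →ₗᵢ[ℝ] EuclideanSpace ℝ (Fin 3), ∃ q ∈ (D : Set (EuclideanSpace ℝ (Fin 3))), μ = (MeasureTheory.Measure.count : MeasureTheory.Measure (EuclideanSpace ℝ (Fin 3))).restrict ((fun s => A (s - q)) '' (D : Set (EuclideanSpace ℝ (Fin 3))))} → (∃ N : ℕ, ∀ x ∈ (D : Set (EuclideanSpace ℝ (Fin 3))), {g : EuclideanSpace ℝ (Fin 3) ≃ᵃⁱ[ℝ] EuclideanSpace ℝ (Fin 3) | g '' (D : Set (EuclideanSpace ℝ (Fin 3))) = (D : Set (EuclideanSpace ℝ (Fin 3))) ∧ g x = x}.encard ≤ N) → Literature.Geometry.DiscreteGeometry.HasFinitelyManySymmetryOrbits (D : Set (EuclideanSpace ℝ (Fin 3)))) →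
    ((∀ S : Set (EuclideanSpace ℝ (Fin 3) ≃ₗᵢ[ℝ] EuclideanSpace ℝ (Fin 3)), S.Infinite → ∀ ε : ℝ, 0 < ε → ∃ A ∈ S, ∃ B ∈ S, A ≠ B ∧ ∀ x : EuclideanSpace ℝ (Fin 3), ‖A x - B x‖ ≤ ε * ‖x‖) ∧
      (∀ A : EuclideanSpace ℝ (Fin 3) ≃ₗᵢ[ℝ] EuclideanSpace ℝ (Fin 3), (∀ x : EuclideanSpace ℝ (Fin 3), ‖A x - x‖ ≤ ‖x‖ / 2) → ∃ u : EuclideanSpace ℝ (Fin 3), ‖u‖ = 1 ∧ A u = u) ∧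
      (∀ A : EuclideanSpace ℝ (Fin 3) ≃ₗᵢ[ℝ] EuclideanSpace ℝ (Fin 3), (∀ x : EuclideanSpace ℝ (Fin 3), ‖A x - x‖ ≤ ‖x‖ / 2) → ∀ u : EuclideanSpace ℝ (Fin 3), ‖u‖ = 1 → A u = u → (∃ x : EuclideanSpace ℝ (Fin 3), A x ≠ x) → ∀ v : EuclideanSpace ℝ (Fin 3), A v = v → ∃ c : ℝ, v = c • u) ∧
      (∀ A B : EuclideanSpace ℝ (Fin 3) ≃ₗᵢ[ℝ] EuclideanSpace ℝ (Fin 3), (∀ x : EuclideanSpace ℝ (Fin 3), ‖A x - x‖ ≤ ‖x‖ / 2) → (∀ x : EuclideanSpace ℝ (Fin 3), ‖B x - x‖ ≤ ‖x‖ / 2) → ∀ u : EuclideanSpace ℝ (Fin 3), ‖u‖ = 1 → A u = u → B u = u → ∀ x : EuclideanSpace ℝ (Fin 3), A (B x) = B (A x)) ∧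
      (∀ A : EuclideanSpace ℝ (Fin 3) ≃ₗᵢ[ℝ] EuclideanSpace ℝ (Fin 3), (∀ x : EuclideanSpace ℝ (Fin 3), ‖A x - x‖ ≤ ‖x‖ / 2) → ∀ u : EuclideanSpace ℝ (Fin 3), ‖u‖ = 1 → A u = u → (∃ x : EuclideanSpace ℝ (Fin 3), A x ≠ x) → ∀ w : EuclideanSpace ℝ (Fin 3), inner ℝ w u = 0 → ∃ c : EuclideanSpace ℝ (Fin 3), inner ℝ c u = 0 ∧ A c - c = w)) →
    ((∀ (D : Delone.DeloneSet (EuclideanSpace ℝ (Fin 3))) (g : EuclideanSpace ℝ (Fin 3) ≃ᵃⁱ[ℝ] EuclideanSpace ℝ (Fin 3)), ∀ x ∈ (D : Set (EuclideanSpace ℝ (Fin 3))), (∀ p ∈ (D : Set (EuclideanSpace ℝ (Fin 3))), dist p x ≤ 20 * (D.coveringRadius : ℝ) → g p = p) → ∀ y : EuclideanSpace ℝ (Fin 3), g y = y) →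
      (∀ A : EuclideanSpace ℝ (Fin 3) ≃ₗᵢ[ℝ] EuclideanSpace ℝ (Fin 3), (∀ x : EuclideanSpace ℝ (Fin 3), ‖A x - x‖ ≤ ‖x‖ / 2) → ∃ u : EuclideanSpace ℝ (Fin 3), ‖u‖ = 1 ∧ A u = u) →
      (∀ A : EuclideanSpace ℝ (Fin 3) ≃ₗᵢ[ℝ] EuclideanSpace ℝ (Fin 3), (∀ x : EuclideanSpace ℝ (Fin 3), ‖A x - x‖ ≤ ‖x‖ / 2) → ∀ u : EuclideanSpace ℝ (Fin 3), ‖u‖ = 1 → A u = u → (∃ x : EuclideanSpace ℝ (Fin 3), A x ≠ x) → ∀ v : EuclideanSpace ℝ (Fin 3), A v = v → ∃ c : ℝ, v = c • u) →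
      (∀ A B : EuclideanSpace ℝ (Fin 3) ≃ₗᵢ[ℝ] EuclideanSpace ℝ (Fin 3), (∀ x : EuclideanSpace ℝ (Fin 3), ‖A x - x‖ ≤ ‖x‖ / 2) → (∀ x : EuclideanSpace ℝ (Fin 3), ‖B x - x‖ ≤ ‖x‖ / 2) → ∀ u : EuclideanSpace ℝ (Fin 3), ‖u‖ = 1 → A u = u → B u = u → ∀ x : EuclideanSpace ℝ (Fin 3), A (B x) = B (A x)) →
      ∀ D : Delone.DeloneSet (EuclideanSpace ℝ (Fin 3)), ∀ g₁ g₂ : EuclideanSpace ℝ (Fin 3) ≃ᵃⁱ[ℝ] EuclideanSpace ℝ (Fin 3), g₁ '' (D : Set (EuclideanSpace ℝ (Fin 3))) = (D : Set (EuclideanSpace ℝ (Fin 3))) → g₂ '' (D : Set (EuclideanSpace ℝ (Fin 3))) = (D : Set (EuclideanSpace ℝ (Fin 3))) → (∀ x : EuclideanSpace ℝ (Fin 3), ‖g₁.linear x - x‖ ≤ ‖x‖ / 10) → (∀ x : EuclideanSpace ℝ (Fin 3), ‖g₂.linear x - x‖ ≤ ‖x‖ / 10) → ∀ x : EuclideanSpace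 ℝ (Fin 3), g₁.linear (g₂.linear x) = g₂.linear (g₁.linear x)) →
    ((∀ S : Set (EuclideanSpace ℝ (Fin 3) ≃ₗᵢ[ℝ] EuclideanSpace ℝ (Fin 3)), S.Infinite → ∀ ε : ℝ, 0 < ε → ∃ A ∈ S, ∃ B ∈ S, A ≠ B ∧ ∀ x : EuclideanSpace ℝ (Fin 3), ‖A x - B x‖ ≤ ε * ‖x‖) →
      (∀ A : EuclideanSpace ℝ (Fin 3) ≃ₗᵢ[ℝ] EuclideanSpace ℝ (Fin 3), (∀ x : EuclideanSpace ℝ (Fin 3), ‖A x - x‖ ≤ ‖x‖ / 2) → ∃ u : EuclideanSpace ℝ (Fin 3), ‖u‖ = 1 ∧ A u = u) →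
      (∀ A : EuclideanSpace ℝ (Fin 3) ≃ₗᵢ[ℝ] EuclideanSpace ℝ (Fin 3), (∀ x : EuclideanSpace ℝ (Fin 3), ‖A x - x‖ ≤ ‖x‖ / 2) → ∀ u : EuclideanSpace ℝ (Fin 3), ‖u‖ = 1 → A u = u → (∃ x : EuclideanSpace ℝ (Fin 3), A x ≠ x) → ∀ v : EuclideanSpace ℝ (Fin 3), A v = v → ∃ c : ℝ, v = c • u) →
      (∀ A : EuclideanSpace ℝ (Fin 3) ≃ₗᵢ[ℝ] EuclideanSpace ℝ (Fin 3), (∀ x : EuclideanSpace ℝ (Fin 3), ‖A x - x‖ ≤ ‖x‖ / 2) → ∀ u : EuclideanSpace ℝ (Fin 3), ‖u‖ = 1 → A u = u → (∃ x : EuclideanSpace ℝ (Fin 3), A x ≠ x) → ∀ w : EuclideanSpace ℝ (Fin 3), inner ℝ w u = 0 → ∃ c : EuclideanSpace ℝ (Fin 3), inner ℝ c u = 0 ∧ A c - c = w) →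
      (∀ D : Delone.DeloneSet (EuclideanSpace ℝ (Fin 3)), ∀ g₁ g₂ : EuclideanSpace ℝ (Fin 3) ≃ᵃⁱ[ℝ] EuclideanSpace ℝ (Fin 3), g₁ '' (D : Set (EuclideanSpace ℝ (Fin 3))) = (D : Set (EuclideanSpace ℝ (Fin 3))) → g₂ '' (D : Set (EuclideanSpace ℝ (Fin 3))) = (D : Set (EuclideanSpace ℝ (Fin 3))) → (∀ x : EuclideanSpace ℝ (Fin 3), ‖g₁.linear x - x‖ ≤ ‖x‖ / 10) → (∀ x : EuclideanSpace ℝ (Fin 3), ‖g₂.linear x - x‖ ≤ ‖x‖ / 10) → ∀ x : EuclideanSpace ℝ (Fin 3), g₁.linear (g₂.linear x) = g₂.linear (g₁.linear x)) →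
      ∀ D : Delone.DeloneSet (EuclideanSpace ℝ (Fin 3)), Literature.Geometry.DiscreteGeometry.HasFinitelyManySymmetryOrbits (D : Set (EuclideanSpace ℝ (Fin 3))) → {A : EuclideanSpace ℝ (Fin 3) ≃ₗᵢ[ℝ] EuclideanSpace ℝ (Fin 3) | ∃ g : EuclideanSpace ℝ (Fin 3) ≃ᵃⁱ[ℝ] EuclideanSpace ℝ (Fin 3), g '' (D : Set (EuclideanSpace ℝ (Fin 3))) = (D : Set (EuclideanSpace ℝ (Fin 3))) ∧ g.linearIsometryEquiv = A}.Finite) →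
    (∀ D : Delone.DeloneSet (EuclideanSpace ℝ (Fin 3)), Literature.Geometry.DiscreteGeometry.HasFinitelyManySymmetryOrbits (D : Set (EuclideanSpace ℝ (Fin 3))) → {A : EuclideanSpace ℝ (Fin 3) ≃ₗᵢ[ℝ] EuclideanSpace ℝ (Fin 3) | ∃ g : EuclideanSpace ℝ (Fin 3) ≃ᵃⁱ[ℝ] EuclideanSpace ℝ (Fin 3), g '' (D : Set (EuclideanSpace ℝ (Fin 3))) = (D : Set (EuclideanSpace ℝ (Fin 3))) ∧ g.linearIsometryEquiv = A}.Finite → ∃ Q : Literature.MathematicalPhysics.StatisticalMechanics.PeriodicConfiguration 3, Q.points = (D : Set (EuclideanSpace ℝ (Fin 3)))) →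
    (∀ δ : ℝ, 0 < δ → ∀ P : MeasureTheory.Measure (MeasureTheory.Measure (EuclideanSpace ℝ (Fin 3))), MeasureTheory.IsProbabilityMeasure P → (∀ᵐ μ ∂P, Literature.Probability.Process.IsRootedHardCore δ μ) → Literature.Probability.Process.IsPointStationaryLaw P → (∀ᵐ μ ∂P, ∃ R₀ : ℝ, ∀ z : EuclideanSpace ℝ (Fin 3), ∃ y : EuclideanSpace ℝ (Fin 3), μ {y} ≠ 0 ∧ dist z y ≤ R₀) → (∃ Y : Set (EuclideanSpace ℝ (Fin 3)), 0 < P {μ | ∃ A : EuclideanSpace ℝ (Fin 3) →ₗᵢ[ℝ] EuclideanSpace ℝ (Fin 3), ∃ q ∈ Y, μ = (MeasureTheory.Measure.count : MeasureTheory.Measure (EuclideanSpace ℝ (Fin 3))).restrict ((fun s => A (s - q)) '' Y)}) → ∃ Q : Literature.MathematicalPhysics.StatisticalMechanics.PeriodicConfiguration 3, ∀ R ε : ℝ, 0 < R → 0 < ε → 0 < P {μ | ∃ A : EuclideanSpace ℝ (Fin 3) →ₗᵢ[ℝ] EuclideanSpace ℝ (Fin 3), ∃ q ∈ Q.points, (∀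 s ∈ Q.points, dist s q ≤ R → ∃ y : EuclideanSpace ℝ (Fin 3), μ {y} ≠ 0 ∧ dist y (A (s - q)) ≤ ε) ∧ (∀ y : EuclideanSpace ℝ (Fin 3), μ {y} ≠ 0 → ‖y‖ ≤ R → ∃ s ∈ Q.points, dist y (A (s - q)) ≤ ε)}) := by
  intro h2 hSB h3 hTK hG1a hFPG hLFP δ hδ P hP hHC hSt hRD hAtom
  obtain ⟨Y, hY⟩ := hAtom
  -- (A) EXTRACTION: the atom event has positive measure, the hard-core and relative-density clauses hold
  -- a.s., so one configuration in the atom event satisfies both.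
  obtain ⟨μ, ⟨A, q, hq, rfl⟩, hμhc, hμrd⟩ :=
    MeasureTheory.Measure.exists_mem_of_measure_ne_zero_of_ae hY.ne'
      (MeasureTheory.ae_restrict_of_ae (hHC.and hRD))
  -- (B) `Y` is a Delone set.
  obtain ⟨D, hDY⟩ := deloneOfRealisedClass δ hδ Y A q hμhc hμrd
  subst hDY
  -- (C) SB (stabiliser bound) + S2 (measurability) + S3' (mass transport): finitely many symmetry orbits.
  obtain ⟨hASL, hStab⟩ := hSB
  have hfin := h3 δ hδ P hP hHC hSt D (h2 D) hY (hStab D)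
  -- (D) TK + G1a + FPG: finite point group; LFP: `Y = Q.points` for a periodic configuration `Q`.
  obtain ⟨hT0, hT1, hT2, hT5, hT7⟩ := hTK
  have hcomm := hG1a hASL hT1 hT2 hT5
  have hPi := hFPG hT0 hT1 hT2 hT7 hcomm D hfin
  obtain ⟨Q, hQ⟩ := hLFP D hfin hPi
  -- (E) WINDOWS: the atom event lies inside every matching event of `Q`.
  refine ⟨Q, fun R ε hR hε => lt_of_lt_of_le hY (MeasureTheory.measure_mono ?_)⟩
  rintro μ ⟨A', q', hq', rfl⟩
  refine ⟨A', q', ?_, ?_, ?_⟩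
  · rw [hQ]; exact hq'
  · intro s hs _
    refine ⟨A' (s - q'), ?_, (dist_self _).trans_le hε.le⟩
    rw [Literature.Probability.Process.count_restrict_singleton_ne_zero_iff]
    exact ⟨s, hQ ▸ hs, rfl⟩
  · intro y hy _
    rw [Literature.Probability.Process.count_restrict_singleton_ne_zero_iff] at hy
    obtain ⟨s, hs, rfl⟩ := hy
    refine ⟨s, ?_, (dist_self _).trans_le hε.le⟩
    rw [hQ]; exact hs

/-- **SKELETON THEOREM `AtomicLawChargesCrystal_of` — the crux BY NAME from the seven registered stubs** (the
only theorem of this file concluding `IsometryAtoms.AtomicLawChargesCrystal`; no hypotheses; its only `sorry`s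
are the ones inside `stub_*`). -/
theorem AtomicLawChargesCrystal_of :
    Summit.AtomisticToContinuum.Crystallization.Theses.IsometryAtoms.AtomicLawChargesCrystal :=
  crux_iff.mpr
    (AtomicLawChargesCrystal_of_stubs stub_measurableSet_isometryClass stub_stabiliserBound
      stub_finiteOrbitsOfChargedClass stub_so3Toolkit stub_smallPartsCommute stub_finitePointGroup
      stub_periodicOfFinitePointGroup)

end Summit.AtomisticToContinuum.Crystallization.Cruxes.AtomicLawChargesCrystal.Sketch

end
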